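import Summits.ABC.ABC.Theorems.IsogenyGlueCongruenceSemistableHeightPolyBound
import Literature.NumberTheory.EllipticCurves.ModularCurveManinSemistableCoprimeFormProofs
import Literature.NumberTheory.DiophantineGeometry.FaltingsHeight
import Literature.NumberTheory.DiophantineGeometry.LocalReduction
import HarnessLib

/-!
# Crux K `TorsionSharingPrimeBound` (stmt-ABC-2157), line `SketchIdeator3g2` — sub-goal
# `absNorm_jDenominatorIdeal_eq_minimalDiscriminantNorm`

Conjunct (d) of the bundle `LevelMismatchFacts` of the line, proved unconditionally: for a
semistable elliptic curve `E/ℚ` given by a global minimal model `W`, the denominator ideal `𝔇` of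
the `j`-invariant (`WeierstrassCurve.jDenominatorIdeal`, `𝔇 = {a ∈ 𝓞 ℚ | a · j ∈ 𝓞 ℚ}`) has norm
`N(𝔇) = |Δ_min| = W.minimalDiscriminantNorm ℤ` (Silverman 1986, *Heights and elliptic curves*, §2,
p. 257: `𝔇 = Δ_{E/K}` for semistable `E/K`).

Proof. `N(𝔇) ≤ |Δ_min|` is the tree's `absNorm_jDenominatorIdeal_le_minimalDiscriminantNorm`
(`Δ ∈ 𝔇`). Conversely let `x ∈ 𝔇`, i.e. `x · j = b ∈ 𝓞 ℚ`; with `j = c₄³ / Δ` for the integral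
model of `W` over `𝓞 ℚ` this reads `x c₄³ = b Δ` in `𝓞 ℚ`. A global minimal model of a semistable
curve has `gcd(c₄, Δ) = 1` (`WeierstrassCurve.isSemistable_iff_isCoprime_c₄_Δ`: at a prime
`p ∣ Δ` the reduction of the `p`-minimal equation `W` is multiplicative, i.e. `p ∤ c₄`; Silverman,
AEC VII.5, Prop. 5.1), so `Δ ∣ x`, i.e. `𝔇 ⊆ (Δ)` and `|Δ_min| = |N(Δ)| = N((Δ)) ∣ N(𝔇) ≠ 0`.

## References

* [Silverman1986] J. H. Silverman, *Heights and elliptic curves*, in Arithmetic Geometry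
  (Cornell–Silverman eds.), Springer 1986, §2 (p. 257).
* [SilvermanAEC2009] J. H. Silverman, *The Arithmetic of Elliptic Curves*, 2nd ed., VII.5
  Prop. 5.1, VIII.8.
-/

noncomputable section

-- `Summit.ABC.ABC` is the mandated summit-side namespace (single-conjunct summit).
set_option linter.dupNamespace false

namespace Summit.ABC.ABC.Theorems.IGCTorsionSharing

open WeierstrassCurve NumberField IsDedekindDomain

/-- `c₄` and `Δ` of the integral model over `𝓞 ℚ` of a globally minimal model of a semistable
elliptic curve over `ℚ` are coprime in `𝓞 ℚ`: transport of the tree's semistability criterion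
`isSemistable_iff_isCoprime_c₄_Δ` (stated for `integralModelInt W`, the same model read in `ℤ`)
along `Rat.ringOfIntegersEquiv : 𝓞 ℚ ≃+* ℤ`. -/
private theorem isCoprime_integralModel_c₄_Δ (W : WeierstrassCurve ℚ) [W.IsElliptic]
    [W.IsGloballyMinimal] (hss : W.IsSemistable ℤ) :
    IsCoprime (W.integralModel (𝓞 ℚ)).c₄ (W.integralModel (𝓞 ℚ)).Δ := by
  have h := ((W.isSemistable_iff_isCoprime_c₄_Δ).1 hss).map
    (Rat.ringOfIntegersEquiv.symm : ℤ ≃+* 𝓞 ℚ).toRingHom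
  have hc : (Rat.ringOfIntegersEquiv.symm : ℤ ≃+* 𝓞 ℚ).toRingHom (integralModelInt W).c₄ =
      (W.integralModel (𝓞 ℚ)).c₄ := by
    rw [integralModelInt, map_c₄]
    exact Rat.ringOfIntegersEquiv.symm_apply_apply _
  have hΔ : (Rat.ringOfIntegersEquiv.symm : ℤ ≃+* 𝓞 ℚ).toRingHom (integralModelInt W).Δ =
      (W.integralModel (𝓞 ℚ)).Δ := by
    rw [integralModelInt, map_Δ]
    exact Rat.ringOfIntegersEquiv.symm_apply_apply _
  rwa [hc, hΔ] at h

/-- **Silverman's remark `𝔇 = Δ_{E/ℚ}` for semistable `E/ℚ`** (conjunct (d) of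
`LevelMismatchFacts`): for a semistable elliptic curve over `ℚ` given by a global minimal model
`W`, the norm of the denominator ideal of `j(E)` is `|Δ_min|`. `≤`: `Δ ∈ 𝔇`
(`absNorm_jDenominatorIdeal_le_minimalDiscriminantNorm`). `≥`: for `x ∈ 𝔇`, `x c₄³ = (x j) Δ`
with `gcd(c₄, Δ) = 1` (semistable + minimal, Silverman AEC VII.5.1) gives `Δ ∣ x`, so `𝔇 ⊆ (Δ)`
and `|Δ_min| = N((Δ)) ∣ N(𝔇)`. [cite: Silverman1986, §2 (p. 257)] -/
theorem absNorm_jDenominatorIdeal_eq_minimalDiscriminantNorm :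
    ∀ (W : WeierstrassCurve ℚ) [W.IsElliptic] [W.IsGloballyMinimal], W.IsSemistable ℤ →
      Ideal.absNorm W.jDenominatorIdeal = W.minimalDiscriminantNorm ℤ := by
  intro W _ _ hss
  refine le_antisymm (absNorm_jDenominatorIdeal_le_minimalDiscriminantNorm W) ?_
  have hcop : IsCoprime (W.integralModel (𝓞 ℚ)).Δ ((W.integralModel (𝓞 ℚ)).c₄ ^ 3) :=
    (isCoprime_integralModel_c₄_Δ W hss).symm.pow_right
  -- `𝔇 ⊆ (Δ)`
  have hle : W.jDenominatorIdeal ≤ Ideal.span {(W.integralModel (𝓞 ℚ)).Δ} := by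
    intro x hx
    rw [mem_jDenominatorIdeal] at hx
    obtain ⟨b, hb⟩ := hx
    rw [Ideal.mem_span_singleton]
    -- `x c₄³ = b Δ` in `𝓞 ℚ`
    have hxc : x * (W.integralModel (𝓞 ℚ)).c₄ ^ 3 = (W.integralModel (𝓞 ℚ)).Δ * b := by
      apply RingOfIntegers.coe_injective
      have hb' : algebraMap (𝓞 ℚ) ℚ x * W.j = algebraMap (𝓞 ℚ) ℚ b := hb
      rw [map_mul, map_mul, map_pow, integralModel_c₄_eq, integralModel_Δ_eq, ← hb',
        WeierstrassCurve.j, ← coe_Δ', mul_comm (W.Δ' : ℚ), mul_assoc, mul_right_comm, Units.inv_mul,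
        one_mul]
    exact hcop.dvd_of_dvd_mul_right ⟨b, hxc⟩
  -- `N((Δ)) ∣ N(𝔇)`
  have hdvd : Ideal.absNorm (Ideal.span {(W.integralModel (𝓞 ℚ)).Δ}) ∣
      Ideal.absNorm W.jDenominatorIdeal :=
    Ideal.absNorm_dvd_absNorm_of_le hle
  rw [Ideal.absNorm_span_singleton] at hdvd
  -- `N(Δ) = Δ_min`
  have hnorm : Algebra.norm ℤ (W.integralModel (𝓞 ℚ)).Δ = minimalDiscriminantInt W := by
    have haΔ : algebraMap (𝓞 ℚ) ℚ (W.integralModel (𝓞 ℚ)).Δ = W.Δ := integralModel_Δ_eq (𝓞 ℚ) W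
    have h1 : ((Algebra.norm ℤ (W.integralModel (𝓞 ℚ)).Δ : ℤ) : ℚ) =
        (minimalDiscriminantInt W : ℚ) := by
      have h2 := Algebra.norm_algebraMap (S := ℚ) (algebraMap (𝓞 ℚ) ℚ (W.integralModel (𝓞 ℚ)).Δ)
      rw [Module.finrank_self, pow_one] at h2
      rw [Algebra.coe_norm_int, cast_minimalDiscriminantInt, ← haΔ]
      exact h2
    exact_mod_cast h1
  rw [hnorm] at hdvd
  rw [minimalDiscriminantNorm_int_eq_natAbs_minimalDiscriminantInt_holds W]
  have h0 : Ideal.absNorm W.jDenominatorIdeal ≠ 0 := by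
    rw [Ne, Ideal.absNorm_eq_zero_iff]
    exact W.jDenominatorIdeal_ne_bot
  exact Nat.le_of_dvd (Nat.pos_of_ne_zero h0) hdvd

end Summit.ABC.ABC.Theorems.IGCTorsionSharing

end
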